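import Mathlib
import Summits.Ventures.PercRepro2.Defs
import Summits.Ventures.PercRepro2.Independence
import Summits.Ventures.PercRepro2.Harris
import Summits.Ventures.PercRepro2.Graph
import Summits.Ventures.PercRepro2.Exploration
import Summits.Ventures.PercRepro2.Events
import Summits.Ventures.PercRepro2.Statements
import Summits.Ventures.PercRepro2.FourFunctions
import Summits.Ventures.PercRepro2.Induced
import Summits.Ventures.PercRepro2.Frontier
import Summits.Ventures.PercRepro2.ObsIndependence
import Summits.Ventures.PercRepro2.BHK
import Summits.Ventures.PercRepro2.BHKEvents
import Summits.Ventures.PercRepro2.ClusterProperty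
import Summits.Ventures.PercRepro2.BHKPair
import Summits.Ventures.PercRepro2.CondAvoidPA
import Summits.Ventures.PercRepro2.CondAvoidZPA
import Summits.Ventures.PercRepro2.BoxUnionDefs
import Summits.Ventures.PercRepro2.BoxUnion
import Summits.Ventures.PercRepro2.BoxUnionPair
import Summits.Ventures.PercRepro2.PairTP2
import Summits.Ventures.PercRepro2.PairTP2Main
import Summits.Ventures.PercRepro2.UnionRowMech

/-!
# The single-exclusion two-status union row is a theorem on every graph (grid form)
(blind cell PercRepro2, mine-1 g39; proofs/MINE1-UNIONROW2.md §2–§3, §6)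

The grid masses `M(k) = P(grid = k, s ↮ t)` of two observed vertices `u, v` (codes `0 = T`,
`1 = N`, `2 = S`) satisfy the three positive-association facts of `UnionRowMech`:
(Q) up-sets of the grid are positively associated under `M` — the (Z)-PA on `{s ↮ t}`;
(R) up-sets inside `{v ≠ T}` are positively associated under `M` restricted there — the (Z)-PA
given `t ↮ {s, v}`; (R′) down-sets inside `{u ≠ S}` likewise — the (Z)-PA given `s ↮ {t, u}`.
All three are instances of `CondAvoid.zpa_given_avoid` for the grid indicators `Φ_A(C_s, C_t)`
(`gridInd`), which are (Z)-monotone for up-sets (`isZMono_gridInd`), once the masses are read as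
expectations (`mass_gridMass_eq`) and the relevant avoidance events identified
(`indicator_Q_eq_avoid_of_mem_R`, `mass_R_eq`). Hence, by `UnionRowMech.single_exclusion_nonneg`:

**THEOREM** (`single_exclusion_row`): for every finite graph, every admissible weight vector and
all up-sets `A, B` of the status grid,
`Z·(Z·M(A∩B) − M(A)M(B)) − M(S,T)·(Z·1_A(S,T) − M(A))·(Z·1_B(S,T) − M(B)) ≥ 0`, `Z = P(s ↮ t)`
— the two-status union row of row 2′CON-U for `X ∋ u`, `Y ∋ v` (single exclusion), for up-set
observables, on EVERY instance, with no log-supermodularity anywhere.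
-/

namespace Summit.Ventures.PercRepro2

namespace UnionRowGrid

open Finset UnionRowMech
open scoped Classical

variable {V : Type*} {E : Type*} [Fintype V] [DecidableEq V] [Fintype E] [DecidableEq E]
variable (ends : E → Sym2 V) (s t u v : V) {p : E → ℝ}

/-! ### The grid masses and the grid indicators -/

/-- The grid masses `M(k) = P(grid = k, s ↮ t)`. -/
noncomputable def gridMass (p : E → ℝ) : Grid → ℝ :=
  fun k => prob p (PairTP2.gridEvent ends s t u v k)

/-- The status code of a vertex from the two clusters. -/
noncomputable def codeOf (W C : Set V) (x : V) : Fin 3 :=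
  if x ∈ W then 2 else if x ∈ C then 0 else 1

/-- The grid indicator of a set of cells, as a functional of the two clusters. -/
noncomputable def gridInd (A : Finset Grid) (W C : Set V) : ℝ :=
  if (codeOf W C u, codeOf W C v) ∈ A then 1 else 0

omit [Fintype V] [DecidableEq V] [Fintype E] [DecidableEq E] in
/-- The code is monotone: larger `C_s`, smaller `C_t` give a larger code. -/
lemma codeOf_mono {W W' C C' : Set V} (hW : W ⊆ W') (hC : C' ⊆ C) (x : V) :
    codeOf W C x ≤ codeOf W' C' x := by
  unfold codeOf
  by_cases h1 : x ∈ W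
  · rw [if_pos h1, if_pos (hW h1)]
  · rw [if_neg h1]
    by_cases h2 : x ∈ C
    · rw [if_pos h2]
      split_ifs <;> decide
    · rw [if_neg h2, if_neg (fun h => h2 (hC h))]
      split_ifs <;> decide

omit [Fintype V] [DecidableEq V] [Fintype E] [DecidableEq E] in
/-- The grid indicator of an up-set is (Z)-monotone. -/
lemma isZMono_gridInd {A : Finset Grid} (hA : IsUp A) : CondAvoid.IsZMono (gridInd u v A) := by
  intro W W' C C' hW hC
  unfold gridInd
  by_cases h : (codeOf W C u, codeOf W C v) ∈ A
  · rw [if_pos h, if_pos (hA ⟨codeOf_mono hW hC u, codeOf_mono hW hC v⟩ h)]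
  · rw [if_neg h]
    split_ifs <;> norm_num

omit [Fintype V] [DecidableEq V] [Fintype E] [DecidableEq E] in
/-- The grid indicator of a down-set is (Z)-monotone with the roles of the clusters exchanged. -/
lemma isZMono_gridInd_swap {A : Finset Grid} (hA : IsDown A) :
    CondAvoid.IsZMono (fun W C => gridInd u v A C W) := by
  intro W W' C C' hW hC
  simp only [gridInd]
  by_cases h : (codeOf C W u, codeOf C W v) ∈ A
  · rw [if_pos h, if_pos (hA ⟨codeOf_mono hC hW u, codeOf_mono hC hW v⟩ h)]
  · rw [if_neg h]
    split_ifs <;> norm_num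

omit [Fintype V] [DecidableEq V] [Fintype E] [DecidableEq E] in
/-- The grid indicator is nonnegative. -/
lemma gridInd_nonneg (A : Finset Grid) (W C : Set V) : 0 ≤ gridInd u v A W C := by
  unfold gridInd
  split_ifs <;> norm_num

omit [Fintype V] [DecidableEq V] [Fintype E] [DecidableEq E] in
/-- The grid indicator is at most one. -/
lemma gridInd_le_one (A : Finset Grid) (W C : Set V) : gridInd u v A W C ≤ 1 := by
  unfold gridInd
  split_ifs <;> norm_num

omit [Fintype V] [DecidableEq V] [Fintype E] [DecidableEq E] in
/-- The product of two grid indicators is the grid indicator of the intersection. -/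
lemma gridInd_mul (A B : Finset Grid) (W C : Set V) :
    gridInd u v A W C * gridInd u v B W C = gridInd u v (A ∩ B) W C := by
  unfold gridInd
  by_cases hA : (codeOf W C u, codeOf W C v) ∈ A <;>
    by_cases hB : (codeOf W C u, codeOf W C v) ∈ B <;>
    simp [hA, hB, Finset.mem_inter]

/-! ### The grid of a configuration -/

omit [DecidableEq E] in
/-- The status code of `PairTP2` is the code of the two clusters. -/
lemma code_eq_codeOf (ω : Config E) (x : V) :
    PairTP2.code ends s t ω x = codeOf (cluster ends ω s) (cluster ends ω t) x := by
  unfold PairTP2.code codeOf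
  by_cases h1 : Conn ends ω s x
  · rw [if_pos h1, if_pos (show x ∈ cluster ends ω s from h1)]
  · rw [if_neg h1, if_neg (show x ∉ cluster ends ω s from h1)]
    by_cases h2 : Conn ends ω t x
    · rw [if_pos h2, if_pos (show x ∈ cluster ends ω t from h2)]
    · rw [if_neg h2, if_neg (show x ∉ cluster ends ω t from h2)]

omit [DecidableEq E] in
/-- The grid of a configuration in terms of the two clusters. -/
lemma grid_eq (ω : Config E) :
    PairTP2.grid ends s t u v ω =
      (codeOf (cluster ends ω s) (cluster ends ω t) u,
        codeOf (cluster ends ω s) (cluster ends ω t) v) := by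
  unfold PairTP2.grid
  rw [code_eq_codeOf, code_eq_codeOf]

omit [DecidableEq E] in
/-- The grid indicator at a configuration is the indicator of `grid ∈ A`. -/
lemma gridInd_cluster (A : Finset Grid) (ω : Config E) :
    gridInd u v A (cluster ends ω s) (cluster ends ω t) =
      if PairTP2.grid ends s t u v ω ∈ A then 1 else 0 := by
  unfold gridInd
  rw [grid_eq]

/-! ### Masses as expectations -/

/-- The mass of a set of cells is the expectation of the grid indicator on `{s ↮ t}`. -/
lemma mass_gridMass_eq (A : Finset Grid) :
    mass (gridMass ends s t u v p) A =
      expect p (fun ω => gridInd u v A (cluster ends ω s) (cluster ends ω t) *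
        ((connEvent ends s t)ᶜ).indicator 1 ω) := by
  unfold mass gridMass
  simp_rw [prob_eq_expect_indicator]
  rw [← CondAvoid.expect_finset_sum]
  refine congrArg (expect p) (funext fun ω => ?_)
  rw [gridInd_cluster]
  by_cases hQ : ω ∈ (connEvent ends s t)ᶜ
  · rw [Set.indicator_of_mem hQ]
    simp only [Pi.one_apply, mul_one]
    have : ∀ k ∈ A, (PairTP2.gridEvent ends s t u v k).indicator (1 : Config E → ℝ) ω =
        if PairTP2.grid ends s t u v ω = k then 1 else 0 := by
      intro k _
      by_cases hk : PairTP2.grid ends s t u v ω = k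
      · rw [if_pos hk, Set.indicator_of_mem (show ω ∈ PairTP2.gridEvent ends s t u v k from ⟨hk, hQ⟩)]
        rfl
      · rw [if_neg hk, Set.indicator_of_notMem (fun h => hk h.1)]
    rw [Finset.sum_congr rfl this, Finset.sum_ite_eq]
  · rw [Set.indicator_of_notMem hQ, mul_zero]
    refine Finset.sum_eq_zero fun k _ => ?_
    exact Set.indicator_of_notMem (fun h => hQ h.2) _

/-- The total mass is `P(s ↮ t)`. -/
lemma total_gridMass_eq : total (gridMass ends s t u v p) = prob p (connEvent ends s t)ᶜ := by
  have h := mass_gridMass_eq ends s t u v (p := p) Finset.univ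
  unfold mass at h
  unfold total
  rw [h, prob_eq_expect_indicator]
  refine congrArg (expect p) (funext fun ω => ?_)
  rw [gridInd_cluster, if_pos (Finset.mem_univ _), one_mul]

/-! ### The avoidance events behind the three restrictions -/

omit [Fintype E] [DecidableEq E] in
omit [Fintype V] [DecidableEq V] in
/-- `{s ↮ t}` is the event that the cluster of `t` avoids `{s}`. -/
lemma compl_connEvent_eq_avoid :
    (connEvent ends s t)ᶜ = CondAvoid.avoidEvent ends t {s} := by
  ext ω
  simp only [Set.mem_compl_iff, connEvent, Set.mem_setOf_eq, CondAvoid.avoidEvent,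
    Finset.mem_singleton, forall_eq]
  exact ⟨fun h h' => h (conn_symm h'), fun h h' => h (conn_symm h')⟩

omit [DecidableEq E] in
/-- On `grid ∈ A` with `A ⊆ R` (`v ≠ T`), the event `{s ↮ t}` is the avoidance of `{s, v}` by
the cluster of `t`. -/
lemma indicator_Q_eq_avoid_of_mem_R {A : Finset Grid} (hAR : A ⊆ R) (ω : Config E) :
    gridInd u v A (cluster ends ω s) (cluster ends ω t) *
        ((connEvent ends s t)ᶜ).indicator (1 : Config E → ℝ) ω =
      gridInd u v A (cluster ends ω s) (cluster ends ω t) *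
        (CondAvoid.avoidEvent ends t {s, v}).indicator 1 ω := by
  rw [gridInd_cluster]
  by_cases hA : PairTP2.grid ends s t u v ω ∈ A
  · rw [if_pos hA, one_mul, one_mul]
    have hv : PairTP2.code ends s t ω v ≠ 0 := by
      have := hAR hA
      simp only [R, Finset.mem_filter, Finset.mem_univ, true_and] at this
      exact this
    rw [Ne, PairTP2.code_eq_zero_iff] at hv
    by_cases hQ : ω ∈ (connEvent ends s t)ᶜ
    · have hav : ω ∈ CondAvoid.avoidEvent ends t {s, v} := by
        intro x hx
        simp only [Finset.mem_insert, Finset.mem_singleton] at hx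
        rcases hx with rfl | rfl
        · exact fun h => hQ (conn_symm h)
        · intro htv
          have hsv : Conn ends ω s x := by
            by_contra hsv
            exact hv ⟨hsv, htv⟩
          exact hQ (conn_trans hsv (conn_symm htv))
      rw [Set.indicator_of_mem hQ, Set.indicator_of_mem hav]
    · have hav : ω ∉ CondAvoid.avoidEvent ends t {s, v} := by
        intro h
        exact hQ (fun h' => h s (by simp) (conn_symm h'))
      rw [Set.indicator_of_notMem hQ, Set.indicator_of_notMem hav]
  · rw [if_neg hA, zero_mul, zero_mul]

omit [DecidableEq E] in
/-- On `grid ∈ A` with `A ⊆ R′` (`u ≠ S`), the event `{s ↮ t}` is the avoidance of `{t, u}` by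
the cluster of `s`. -/
lemma indicator_Q_eq_avoid_of_mem_R' {A : Finset Grid} (hAR : A ⊆ R') (ω : Config E) :
    gridInd u v A (cluster ends ω s) (cluster ends ω t) *
        ((connEvent ends s t)ᶜ).indicator (1 : Config E → ℝ) ω =
      gridInd u v A (cluster ends ω s) (cluster ends ω t) *
        (CondAvoid.avoidEvent ends s {t, u}).indicator 1 ω := by
  rw [gridInd_cluster]
  by_cases hA : PairTP2.grid ends s t u v ω ∈ A
  · rw [if_pos hA, one_mul, one_mul]
    have hu : PairTP2.code ends s t ω u ≠ 2 := by
      have := hAR hA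
      simp only [R', Finset.mem_filter, Finset.mem_univ, true_and] at this
      exact this
    rw [Ne, PairTP2.code_eq_two_iff] at hu
    by_cases hQ : ω ∈ (connEvent ends s t)ᶜ
    · have hav : ω ∈ CondAvoid.avoidEvent ends s {t, u} := by
        intro x hx
        simp only [Finset.mem_insert, Finset.mem_singleton] at hx
        rcases hx with rfl | rfl
        · exact hQ
        · exact hu
      rw [Set.indicator_of_mem hQ, Set.indicator_of_mem hav]
    · have hav : ω ∉ CondAvoid.avoidEvent ends s {t, u} := by
        intro h
        exact hQ (h t (by simp))
      rw [Set.indicator_of_notMem hQ, Set.indicator_of_notMem hav]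
  · rw [if_neg hA, zero_mul, zero_mul]

/-- The mass of `R` is the probability that the cluster of `t` avoids `{s, v}`. -/
lemma mass_R_eq : mass (gridMass ends s t u v p) R = prob p (CondAvoid.avoidEvent ends t {s, v}) := by
  rw [mass_gridMass_eq, prob_eq_expect_indicator]
  refine congrArg (expect p) (funext fun ω => ?_)
  rw [indicator_Q_eq_avoid_of_mem_R ends s t u v (subset_refl R), gridInd_cluster]
  by_cases hav : ω ∈ CondAvoid.avoidEvent ends t {s, v}
  · rw [Set.indicator_of_mem hav, Pi.one_apply, mul_one]
    have hR : PairTP2.grid ends s t u v ω ∈ R := by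
      simp only [R, Finset.mem_filter, Finset.mem_univ, true_and, PairTP2.grid]
      rw [Ne, PairTP2.code_eq_zero_iff]
      exact fun h => hav v (by simp) h.2
    rw [if_pos hR]
  · rw [Set.indicator_of_notMem hav, mul_zero]

/-- The mass of `R′` is the probability that the cluster of `s` avoids `{t, u}`. -/
lemma mass_R'_eq :
    mass (gridMass ends s t u v p) R' = prob p (CondAvoid.avoidEvent ends s {t, u}) := by
  rw [mass_gridMass_eq, prob_eq_expect_indicator]
  refine congrArg (expect p) (funext fun ω => ?_)
  rw [indicator_Q_eq_avoid_of_mem_R' ends s t u v (subset_refl R'), gridInd_cluster]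
  by_cases hav : ω ∈ CondAvoid.avoidEvent ends s {t, u}
  · rw [Set.indicator_of_mem hav, Pi.one_apply, mul_one]
    have hR : PairTP2.grid ends s t u v ω ∈ R' := by
      simp only [R', Finset.mem_filter, Finset.mem_univ, true_and, PairTP2.grid]
      rw [Ne, PairTP2.code_eq_two_iff]
      exact hav u (by simp)
    rw [if_pos hR]
  · rw [Set.indicator_of_notMem hav, mul_zero]

/-! ### The three positive-association facts -/

/-- **(Q)**: up-sets of the grid are positively associated under the grid masses — the (Z)-PA on
`{s ↮ t}`. -/
theorem pa_Q (hp : IsProbVec p) (A B : Finset Grid) (hA : IsUp A) (hB : IsUp B) :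
    mass (gridMass ends s t u v p) A * mass (gridMass ends s t u v p) B ≤
      mass (gridMass ends s t u v p) (A ∩ B) * total (gridMass ends s t u v p) := by
  have key := CondAvoid.zpa_given_avoid p hp ends s t (X := {s}) (Finset.mem_singleton_self s)
    (isZMono_gridInd u v hA) (isZMono_gridInd u v hB) (gridInd_nonneg u v A)
    (gridInd_nonneg u v B) (gridInd_le_one u v A) (gridInd_le_one u v B)
  rw [← compl_connEvent_eq_avoid] at key
  simp only [gridInd_mul] at key
  rw [mass_gridMass_eq, mass_gridMass_eq, mass_gridMass_eq, total_gridMass_eq]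
  exact key

/-- **(R)**: up-sets inside `{v ≠ T}` are positively associated under the grid masses restricted
there — the (Z)-PA given `t ↮ {s, v}`. -/
theorem pa_R (hp : IsProbVec p) (A B : Finset Grid) (hA : IsUp A) (hB : IsUp B) (hAR : A ⊆ R)
    (hBR : B ⊆ R) :
    mass (gridMass ends s t u v p) A * mass (gridMass ends s t u v p) B ≤
      mass (gridMass ends s t u v p) (A ∩ B) * mass (gridMass ends s t u v p) R := by
  have key := CondAvoid.zpa_given_avoid p hp ends s t (X := {s, v}) (by simp)
    (isZMono_gridInd u v hA) (isZMono_gridInd u v hB) (gridInd_nonneg u v A)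
    (gridInd_nonneg u v B) (gridInd_le_one u v A) (gridInd_le_one u v B)
  simp only [gridInd_mul] at key
  rw [mass_gridMass_eq, mass_gridMass_eq, mass_gridMass_eq, mass_R_eq]
  have hABR : A ∩ B ⊆ R := fun k hk => hAR (Finset.mem_inter.1 hk).1
  simp_rw [indicator_Q_eq_avoid_of_mem_R ends s t u v hAR,
    indicator_Q_eq_avoid_of_mem_R ends s t u v hBR,
    indicator_Q_eq_avoid_of_mem_R ends s t u v hABR]
  exact key

/-- **(R′)**: down-sets inside `{u ≠ S}` are positively associated under the grid masses
restricted there — the (Z)-PA given `s ↮ {t, u}` (the roles of `s, t` exchanged). -/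
theorem pa_R' (hp : IsProbVec p) (A B : Finset Grid) (hA : IsDown A) (hB : IsDown B)
    (hAR : A ⊆ R') (hBR : B ⊆ R') :
    mass (gridMass ends s t u v p) A * mass (gridMass ends s t u v p) B ≤
      mass (gridMass ends s t u v p) (A ∩ B) * mass (gridMass ends s t u v p) R' := by
  have key := CondAvoid.zpa_given_avoid p hp ends t s (X := {t, u}) (by simp)
    (isZMono_gridInd_swap u v hA) (isZMono_gridInd_swap u v hB)
    (fun W C => gridInd_nonneg u v A C W) (fun W C => gridInd_nonneg u v B C W)
    (fun W C => gridInd_le_one u v A C W) (fun W C => gridInd_le_one u v B C W)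
  simp only [gridInd_mul] at key
  rw [mass_gridMass_eq, mass_gridMass_eq, mass_gridMass_eq, mass_R'_eq]
  have hABR : A ∩ B ⊆ R' := fun k hk => hAR (Finset.mem_inter.1 hk).1
  simp_rw [indicator_Q_eq_avoid_of_mem_R' ends s t u v hAR,
    indicator_Q_eq_avoid_of_mem_R' ends s t u v hBR,
    indicator_Q_eq_avoid_of_mem_R' ends s t u v hABR]
  exact key

/-- The grid masses are nonnegative. -/
lemma gridMass_nonneg (hp : IsProbVec p) (k : Grid) : 0 ≤ gridMass ends s t u v p k :=
  prob_nonneg hp _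

/-! ### The theorem -/

/-- **The single-exclusion two-status union row holds on every graph** (grid form): for every
admissible weight vector and all up-sets `A, B` of the status grid,
`Z·(Z·M(A∩B) − M(A)M(B)) − M(S,T)·(Z·1_A(S,T) − M(A))·(Z·1_B(S,T) − M(B)) ≥ 0`,
`M = gridMass`, `Z = P(s ↮ t)`. -/
theorem single_exclusion_row (hp : IsProbVec p) {A B : Finset Grid} (hA : IsUp A) (hB : IsUp B) :
    0 ≤ total (gridMass ends s t u v p) *
        (total (gridMass ends s t u v p) * mass (gridMass ends s t u v p) (A ∩ B) -
          mass (gridMass ends s t u v p) A * mass (gridMass ends s t u v p) B) -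
      gridMass ends s t u v p UnionRowMech.ST *
        (total (gridMass ends s t u v p) * (if UnionRowMech.ST ∈ A then 1 else 0) -
          mass (gridMass ends s t u v p) A) *
        (total (gridMass ends s t u v p) * (if UnionRowMech.ST ∈ B then 1 else 0) -
          mass (gridMass ends s t u v p) B) :=
  single_exclusion_nonneg (gridMass_nonneg ends s t u v hp)
    (fun A B hA hB => pa_Q ends s t u v hp A B hA hB)
    (fun A B hA hB hAR hBR => pa_R ends s t u v hp A B hA hB hAR hBR)
    (fun A B hA hB hAR hBR => pa_R' ends s t u v hp A B hA hB hAR hBR) hA hB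

end UnionRowGrid

end Summit.Ventures.PercRepro2
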